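import Mathlib
import Literature.Probability.Percolation.PercolationProofs
import Literature.Probability.LatticeModels.ProdBernoulliIndependence
import Literature.Probability.LatticeModels.ProdBernoulliClusterLocality
import Literature.Probability.Percolation.KozmaNitzanPinning
import Summits.CriticalPhenomena.PercolationContinuityZ3.Theorems.PercNearOneGluingNoHeavyLowerTailFatMinorityCertificates
import HarnessLib

/-!
# `NoHeavyLowerTail` (stmt-CriticalPhenomena-4575), line fat-minority-linear — KOZMA–NITZAN'S MOVING
# ANCHOR IS CERTIFIED (the per-piece certificate)

Route task `nh-dp-fatminority` (gen 5).  One-layer observer `o` (private units `X`, coins arbitrary),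
relays `A ∋ b`.  For a fired set `B ⊆ X` let `ν_B = prodBernoulli (pinW w (coins ∪ B×A) ∅)` — the graph
`G ∖ o` with every attachment of `B` deleted (Kozma–Nitzan's `G ∖ W`).
* `movingAnchor_certificate` — if `ν_B(a ↔ b) ≤ ν_B(c ↔ b)` then the glued comparison of
  `orderedAnchor_glued` / `oneLayer_orderedAnchor_family` holds for the piece `(c, x)` of row `B`, for ANY
  injective rank: re-weighting inside the pendant blob `{o} ∪ B` (coins of `B`, pairs `B–c`) does not
  change the comparison (`real_openConn_eq_of_blob`), and releasing the attachments of `B` into later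
  relays one by one preserves it (`le_of_le_closed`, the signed Lemma 3(i)).
The unconditional gluing bound that follows is in `…FatMinorityMovingAnchor`.  No new definitions.
-/

namespace Summit.CriticalPhenomena.PercolationContinuityZ3.Theorems

open MeasureTheory Set
open Literature.Probability.LatticeModels (prodBernoulli)
open Literature.Probability.Percolation (BondConfig openConn openGraph openGraph_adj openEdgeCluster)
open scoped BigOperators

noncomputable section
open Classical
open Literature.Probability.LatticeModels Literature.Probability.Percolation

variable {n : ℕ}

/-- **The moving anchor is certified.**  `o ∉ X ∪ A`, `B ⊆ X`, `X ∩ A = ∅`, `o`'s positive pairs go to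
`X` only, units' positive pairs go to `A ∪ {o}` only; `a, c ∈ A`, `x ∈ B`; `rk` injective on `A`.
If `a ≤ c` in `ν_B = pinW w (K ∪ B×A) ∅` (`K` = coins), then
`μ_{B,c,x}(a ↔ b) ≤ μ_{B,c,x}(o ↔ b)` for the row-`B` piece weighting of `oneLayer_orderedAnchor_family`.
[cite: KozmaNitzan2024, §3.2 Lemma 5 and Theorem 4 (p. 13)] -/
theorem movingAnchor_certificate (w : Sym2 (Fin n) → unitInterval) (X B A : Finset (Fin n))
    (o a b c x : Fin n) (rk : Fin n → ℕ) (hrk : Set.InjOn rk ↑A)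
    (hoX : o ∉ X) (hoA : o ∉ A) (hBX : B ⊆ X) (hXA : Disjoint X A)
    (hstar0 : ∀ y : Fin n, y ≠ o → y ∉ X → w s(o, y) = 0)
    (hunit : ∀ y ∈ X, ∀ z : Fin n, z ≠ o → z ∉ A → w s(y, z) = 0)
    (ha : a ∈ A) (hc : c ∈ A) (hb : b ∈ A) (hx : x ∈ B)
    (hle : (prodBernoulli (pinW w ((↑(X.image fun y => s(o, y)) : Set (Sym2 (Fin n))) ∪
        ↑((B ×ˢ A).image fun p => s(p.1, p.2))) ∅)).real (openConn a b) ≤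
      (prodBernoulli (pinW w ((↑(X.image fun y => s(o, y)) : Set (Sym2 (Fin n))) ∪
        ↑((B ×ˢ A).image fun p => s(p.1, p.2))) ∅)).real (openConn c b)) :
    (prodBernoulli (pinW (pinW (pinW w
        (↑(X.image fun y => s(o, y)) : Set (Sym2 (Fin n))) (↑(B.image fun y => s(o, y)) : Set (Sym2 (Fin n))))
        (↑((B ×ˢ A.filter fun d => rk d < rk c).image fun p => s(p.1, p.2)) : Set (Sym2 (Fin n))) ∅)
        (↑(insert s(x, c) ((B.filter fun x' => x' < x).image fun x' => s(x', c))) : Set (Sym2 (Fin n)))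
        {s(x, c)})).real (openConn a b) ≤
    (prodBernoulli (pinW (pinW (pinW w
        (↑(X.image fun y => s(o, y)) : Set (Sym2 (Fin n))) (↑(B.image fun y => s(o, y)) : Set (Sym2 (Fin n))))
        (↑((B ×ˢ A.filter fun d => rk d < rk c).image fun p => s(p.1, p.2)) : Set (Sym2 (Fin n))) ∅)
        (↑(insert s(x, c) ((B.filter fun x' => x' < x).image fun x' => s(x', c))) : Set (Sym2 (Fin n)))
        {s(x, c)})).real (openConn o b) := by
  have hmeas : ∀ E : Set (BondConfig (Fin n)), MeasurableSet E := fun _ => MeasurableSet.of_discrete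
  -- names
  set K : Finset (Sym2 (Fin n)) := X.image fun y => s(o, y) with hK
  set PB : Finset (Sym2 (Fin n)) := B.image fun y => s(o, y) with hPB
  set TB : Finset (Sym2 (Fin n)) := (B ×ˢ A).image fun p => s(p.1, p.2) with hTB
  set Tc : Finset (Sym2 (Fin n)) := (B ×ˢ A.filter fun d => rk d < rk c).image fun p => s(p.1, p.2) with hTc
  set Lt : Finset (Sym2 (Fin n)) := (B ×ˢ A.filter fun d => rk c < rk d).image fun p => s(p.1, p.2) with hLt
  set Fx : Finset (Sym2 (Fin n)) := insert s(x, c) ((B.filter fun x' => x' < x).image fun x' => s(x', c))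
    with hFx
  set wν := pinW w ((↑K : Set (Sym2 (Fin n))) ∪ ↑TB) ∅ with hwν
  set wf := pinW (pinW (pinW w (↑K : Set (Sym2 (Fin n))) ↑PB) (↑Tc : Set (Sym2 (Fin n))) ∅)
    (↑Fx : Set (Sym2 (Fin n))) {s(x, c)} with hwf
  -- basic facts
  have hxX : x ∈ X := hBX hx
  have hxo : x ≠ o := fun h => hoX (h ▸ hxX)
  have hxA : x ∉ A := fun h => Finset.disjoint_left.1 hXA hxX h
  have hxc : x ≠ c := fun h => hxA (h ▸ hc)
  have hco : c ≠ o := fun h => hoA (h ▸ hc)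
  have hao : a ≠ o := fun h => hoA (h ▸ ha)
  have hBA : ∀ y ∈ B, y ∉ A := fun y hy h => Finset.disjoint_left.1 hXA (hBX hy) h
  have hBo : ∀ y ∈ B, y ≠ o := fun y hy h => hoX (h ▸ hBX hy)
  -- membership computations
  have hK_iff : ∀ u v : Fin n, s(u, v) ∈ K ↔ (u = o ∧ v ∈ X) ∨ (v = o ∧ u ∈ X) := by
    intro u v
    constructor
    · intro h
      obtain ⟨y, hy, hye⟩ := Finset.mem_image.1 h
      rcases Sym2.eq_iff.1 hye with ⟨h1, h2⟩ | ⟨h1, h2⟩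
      · exact Or.inl ⟨h1.symm, h2 ▸ hy⟩
      · exact Or.inr ⟨h1.symm, h2 ▸ hy⟩
    · rintro (⟨rfl, hv⟩ | ⟨rfl, hu⟩)
      · exact Finset.mem_image.2 ⟨v, hv, rfl⟩
      · exact Finset.mem_image.2 ⟨u, hu, Sym2.eq_swap⟩
  have hpair_iff : ∀ (S : Finset (Fin n)) (u v : Fin n), (∀ y ∈ S, y ∈ A) →
      (s(u, v) ∈ (B ×ˢ S).image (fun p : Fin n × Fin n => s(p.1, p.2)) ↔
        (u ∈ B ∧ v ∈ S) ∨ (v ∈ B ∧ u ∈ S)) := by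
    intro S u v hSA
    constructor
    · intro h
      obtain ⟨p, hp, hpe⟩ := Finset.mem_image.1 h
      obtain ⟨hp1, hp2⟩ := Finset.mem_product.1 hp
      rcases Sym2.eq_iff.1 hpe with ⟨h1, h2⟩ | ⟨h1, h2⟩
      · exact Or.inl ⟨h1 ▸ hp1, h2 ▸ hp2⟩
      · exact Or.inr ⟨h1 ▸ hp1, h2 ▸ hp2⟩
    · rintro (⟨hu, hv⟩ | ⟨hv, hu⟩)
      · exact Finset.mem_image.2 ⟨(u, v), Finset.mem_product.2 ⟨hu, hv⟩, rfl⟩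
      · exact Finset.mem_image.2 ⟨(v, u), Finset.mem_product.2 ⟨hv, hu⟩, Sym2.eq_swap⟩
  have hAfilt1 : ∀ y ∈ A.filter (fun d => rk d < rk c), y ∈ A := fun y hy => (Finset.mem_filter.1 hy).1
  have hAfilt2 : ∀ y ∈ A.filter (fun d => rk c < rk d), y ∈ A := fun y hy => (Finset.mem_filter.1 hy).1
  have hAall : ∀ y ∈ A, y ∈ A := fun y hy => hy
  -- the star pairs of `B` and the pair `s(x,c)` have weight 1 under `wf`
  have hstar_notFx : ∀ y ∈ B, s(o, y) ∉ (↑Fx : Set (Sym2 (Fin n))) := by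
    intro y hy h
    rcases Finset.mem_insert.1 (Finset.mem_coe.1 h) with h | h
    · rcases Sym2.eq_iff.1 h with ⟨h1, _⟩ | ⟨h1, _⟩
      · exact hxo h1.symm
      · exact hco h1.symm
    · obtain ⟨x', hx', hx'e⟩ := Finset.mem_image.1 h
      have hx'B : x' ∈ B := (Finset.mem_filter.1 hx').1
      rcases Sym2.eq_iff.1 hx'e with ⟨h1, _⟩ | ⟨_, h2⟩
      · exact hBo x' hx'B h1
      · exact hco h2
  have hstar_notTc : ∀ y : Fin n, s(o, y) ∉ (↑Tc : Set (Sym2 (Fin n))) := by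
    intro y h
    rcases (hpair_iff _ o y hAfilt1).1 (Finset.mem_coe.1 h) with ⟨ho, _⟩ | ⟨_, ho⟩
    · exact hBo o ho rfl
    · exact hoA (hAfilt1 o ho)
  have hwf_star : ∀ y ∈ B, wf s(o, y) = 1 := by
    intro y hy
    have h3 : s(o, y) ∈ (↑K : Set (Sym2 (Fin n))) := Finset.mem_coe.2 ((hK_iff o y).2 (Or.inl ⟨rfl, hBX hy⟩))
    have h4 : s(o, y) ∈ (↑PB : Set (Sym2 (Fin n))) := Finset.mem_coe.2 (Finset.mem_image.2 ⟨y, hy, rfl⟩)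
    rw [hwf, pinW_apply_of_not_mem _ _ (hstar_notFx y hy), pinW_apply_of_not_mem _ _ (hstar_notTc y),
      pinW_apply_of_mem_of_mem _ h3 h4]
  have hwf_xc : wf s(x, c) = 1 := by
    rw [hwf, pinW_apply_of_mem_of_mem _ (Finset.mem_coe.2 (Finset.mem_insert_self _ _)) (Set.mem_singleton _)]
  set μf := prodBernoulli wf with hμf
  -- Step A: under `wf`, `c ↔ b` implies `o ↔ b` a.s. (`o – x – c` is a weight-1 path)
  have hA : μf.real (openConn c b) ≤ μf.real (openConn o b) := by
    set Null : Set (BondConfig (Fin n)) := {ω | s(o, x) ∉ ω} ∪ {ω | s(x, c) ∉ ω} with hNull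
    have hN0 : μf.real Null = 0 := by
      refine le_antisymm ((measureReal_union_le _ _).trans (le_of_eq ?_)) measureReal_nonneg
      rw [hμf, prodBernoulli_real_setOf_notMem, prodBernoulli_real_setOf_notMem, hwf_star x hx, hwf_xc]
      simp
    calc μf.real (openConn c b) ≤ μf.real (openConn o b ∪ Null) := by
          refine measureReal_mono (fun ω hω => ?_) (measure_ne_top _ _)
          by_cases h1 : s(o, x) ∈ ω
          · by_cases h2 : s(x, c) ∈ ω
            · left
              have hox : (openGraph ω).Adj o x := (openGraph_adj ω o x).2 ⟨h1, hxo.symm⟩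
              have hxc' : (openGraph ω).Adj x c := (openGraph_adj ω x c).2 ⟨h2, hxc⟩
              exact (hox.reachable.trans hxc'.reachable).trans hω
            · exact Or.inr (Or.inr h2)
          · exact Or.inr (Or.inl h1)
      _ ≤ μf.real (openConn o b) + μf.real Null := measureReal_union_le _ _
      _ = μf.real (openConn o b) := by rw [hN0, add_zero]
  refine le_trans ?_ hA
  -- Step B: `a ≤ c` under `wf`, transported from `ν_B`
  -- the weighting with a set `L` of later attachments pinned closed
  set wL : Finset (Sym2 (Fin n)) → (Sym2 (Fin n) → unitInterval) := fun L => pinW wf (↑L : Set (Sym2 (Fin n))) ∅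
    with hwL
  -- (B0) pendant blob: `ν_B` and `wL Lt` give the same connection probabilities among `A`-vertices
  have hLt_sub_TB : ∀ f ∈ Lt, f ∈ TB := by
    intro f hf
    obtain ⟨p, hp, rfl⟩ := Finset.mem_image.1 hf
    obtain ⟨hp1, hp2⟩ := Finset.mem_product.1 hp
    exact Finset.mem_image.2 ⟨p, Finset.mem_product.2 ⟨hp1, hAfilt2 _ hp2⟩, rfl⟩
  have hTc_sub_TB : ∀ f ∈ Tc, f ∈ TB := by
    intro f hf
    obtain ⟨p, hp, rfl⟩ := Finset.mem_image.1 hf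
    obtain ⟨hp1, hp2⟩ := Finset.mem_product.1 hp
    exact Finset.mem_image.2 ⟨p, Finset.mem_product.2 ⟨hp1, hAfilt1 _ hp2⟩, rfl⟩
  have hcase : ∀ u v : Fin n, u ∉ insert o B → u ≠ c → wν s(u, v) = wL Lt s(u, v) := by
    intro u v huW huc
    have huo : u ≠ o := fun h => huW (h ▸ Finset.mem_insert_self o B)
    have huB : u ∉ B := fun h => huW (Finset.mem_insert_of_mem h)
    have nFx : s(u, v) ∉ (↑Fx : Set (Sym2 (Fin n))) := by
      intro h
      rcases Finset.mem_insert.1 (Finset.mem_coe.1 h) with h | h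
      · rcases Sym2.eq_iff.1 h with ⟨h1, _⟩ | ⟨h1, _⟩
        · exact huB (h1 ▸ hx)
        · exact huc h1
      · obtain ⟨x', hx', hx'e⟩ := Finset.mem_image.1 h
        have hx'B : x' ∈ B := (Finset.mem_filter.1 hx').1
        rcases Sym2.eq_iff.1 hx'e with ⟨h1, _⟩ | ⟨_, h2⟩
        · exact huB (h1 ▸ hx'B)
        · exact huc h2.symm
    have nPB : s(u, v) ∉ (↑PB : Set (Sym2 (Fin n))) := by
      intro h
      obtain ⟨y, hy, hye⟩ := Finset.mem_image.1 (Finset.mem_coe.1 h)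
      rcases Sym2.eq_iff.1 hye with ⟨h1, _⟩ | ⟨_, h2⟩
      · exact huo h1.symm
      · exact huB (h2 ▸ hy)
    simp only [hwL]
    by_cases hLt' : s(u, v) ∈ (↑Lt : Set (Sym2 (Fin n)))
    · have hTB' : s(u, v) ∈ ((↑K : Set (Sym2 (Fin n))) ∪ ↑TB) :=
        Or.inr (Finset.mem_coe.2 (hLt_sub_TB _ (Finset.mem_coe.1 hLt')))
      rw [hwν, pinW_apply_of_mem_of_not_mem w hTB' (Set.notMem_empty _),
        pinW_apply_of_mem_of_not_mem wf hLt' (Set.notMem_empty _)]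
    rw [pinW_apply_of_not_mem wf _ hLt', hwf, pinW_apply_of_not_mem _ _ nFx]
    by_cases hTc' : s(u, v) ∈ (↑Tc : Set (Sym2 (Fin n)))
    · have hTB' : s(u, v) ∈ ((↑K : Set (Sym2 (Fin n))) ∪ ↑TB) :=
        Or.inr (Finset.mem_coe.2 (hTc_sub_TB _ (Finset.mem_coe.1 hTc')))
      rw [hwν, pinW_apply_of_mem_of_not_mem w hTB' (Set.notMem_empty _),
        pinW_apply_of_mem_of_not_mem _ hTc' (Set.notMem_empty _)]
    rw [pinW_apply_of_not_mem _ _ hTc']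
    by_cases hK' : s(u, v) ∈ (↑K : Set (Sym2 (Fin n)))
    · have hKTB : s(u, v) ∈ ((↑K : Set (Sym2 (Fin n))) ∪ ↑TB) := Or.inl hK'
      rw [hwν, pinW_apply_of_mem_of_not_mem w hKTB (Set.notMem_empty _),
        pinW_apply_of_mem_of_not_mem w hK' nPB]
    rw [pinW_apply_of_not_mem w _ hK']
    have nTB : s(u, v) ∉ ((↑K : Set (Sym2 (Fin n))) ∪ ↑TB) := by
      rintro (h | h)
      · exact hK' h
      · rcases (hpair_iff A u v hAall).1 (Finset.mem_coe.1 h) with ⟨hu, _⟩ | ⟨hv, hu⟩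
        · exact huB hu
        · rcases lt_trichotomy (rk u) (rk c) with hlt | heq | hgt
          · exact hTc' (Finset.mem_coe.2 ((hpair_iff _ u v hAfilt1).2
              (Or.inr ⟨hv, Finset.mem_filter.2 ⟨hu, hlt⟩⟩)))
          · exact huc (hrk (Finset.mem_coe.2 hu) (Finset.mem_coe.2 hc) heq)
          · exact hLt' (Finset.mem_coe.2 ((hpair_iff _ u v hAfilt2).2
              (Or.inr ⟨hv, Finset.mem_filter.2 ⟨hu, hgt⟩⟩)))
    rw [hwν, pinW_apply_of_not_mem w _ nTB]
  have hagree : ∀ f : Sym2 (Fin n), ¬ (∀ y ∈ f, y ∈ insert o B ∨ y = c) → wν f = wL Lt f := by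
    refine Sym2.ind (fun u v => ?_)
    intro hf
    by_cases hu : u ∈ insert o B ∨ u = c
    · by_cases hv : v ∈ insert o B ∨ v = c
      · exact absurd (fun y hy => by
          rcases Sym2.mem_iff.1 hy with rfl | rfl
          · exact hu
          · exact hv) hf
      · rw [not_or] at hv
        rw [Sym2.eq_swap]
        exact hcase v u hv.1 hv.2
    · rw [not_or] at hu
      exact hcase u v hu.1 hu.2
  have hiso : ∀ z ∈ insert o B, ∀ y : Fin n, y ∉ insert o B → y ≠ c → wν s(z, y) = 0 := by
    intro z hz y hyW hyc
    have hyo : y ≠ o := fun h => hyW (h ▸ Finset.mem_insert_self o B)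
    have hyB : y ∉ B := fun h => hyW (Finset.mem_insert_of_mem h)
    by_cases h : s(z, y) ∈ ((↑K : Set (Sym2 (Fin n))) ∪ ↑TB)
    · rw [hwν, pinW_apply_of_mem_of_not_mem w h (Set.notMem_empty _)]
    rw [hwν, pinW_apply_of_not_mem w _ h]
    rcases Finset.mem_insert.1 hz with rfl | hzB
    · by_cases hyX : y ∈ X
      · exact absurd (Or.inl (Finset.mem_coe.2 ((hK_iff z y).2 (Or.inl ⟨rfl, hyX⟩)))) h
      · exact hstar0 y hyo hyX
    · by_cases hyA : y ∈ A
      · exact absurd (Or.inr (Finset.mem_coe.2 ((hpair_iff A z y hAall).2 (Or.inl ⟨hzB, hyA⟩)))) h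
      · exact hunit z (hBX hzB) y hyo hyA
  have haW : a ∉ insert o B := by
    intro h
    rcases Finset.mem_insert.1 h with h | h
    · exact hao h
    · exact hBA a h ha
  have hcW : c ∉ insert o B := by
    intro h
    rcases Finset.mem_insert.1 h with h | h
    · exact hco h
    · exact hBA c h hc
  have hbW : b ∉ insert o B := by
    intro h
    rcases Finset.mem_insert.1 h with h | h
    · exact hoA (h ▸ hb)
    · exact hBA b h hb
  have hbase : (prodBernoulli (wL Lt)).real (openConn a b) ≤ (prodBernoulli (wL Lt)).real (openConn c b) := by
    rw [← real_openConn_eq_of_blob wν (wL Lt) (insert o B) c a b haW hbW hagree hiso,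
      ← real_openConn_eq_of_blob wν (wL Lt) (insert o B) c c b hcW hbW hagree hiso]
    exact hle
  -- (B1) release the later attachments one by one
  have hstar_notLt : ∀ y : Fin n, s(o, y) ∉ Lt := by
    intro y h
    rcases (hpair_iff _ o y hAfilt2).1 h with ⟨ho, _⟩ | ⟨_, ho⟩
    · exact hBo o ho rfl
    · exact hoA (hAfilt2 o ho)
  have hxc_notLt : s(x, c) ∉ Lt := by
    intro h
    rcases (hpair_iff _ x c hAfilt2).1 h with ⟨_, hc'⟩ | ⟨hcB, _⟩
    · exact lt_irrefl _ (Finset.mem_filter.1 hc').2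
    · exact hBA c hcB hc
  have hind : ∀ L' : Finset (Sym2 (Fin n)), L' ⊆ Lt →
      (prodBernoulli (wL (Lt \ L'))).real (openConn a b) ≤
        (prodBernoulli (wL (Lt \ L'))).real (openConn c b) := by
    intro L'
    induction L' using Finset.induction_on with
    | empty => intro _; rw [Finset.sdiff_empty]; exact hbase
    | insert e L' heL' ih =>
        intro hsub
        have heLt : e ∈ Lt := hsub (Finset.mem_insert_self _ _)
        have ih' := ih (fun f hf => hsub (Finset.mem_insert_of_mem hf))
        obtain ⟨p, hp, hpe⟩ := Finset.mem_image.1 heLt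
        obtain ⟨hp1, hp2⟩ := Finset.mem_product.1 hp
        have hp2A : p.2 ∈ A := hAfilt2 _ hp2
        have hp2c : rk c < rk p.2 := (Finset.mem_filter.1 hp2).2
        have hp1o : p.1 ≠ o := hBo _ hp1
        have hp12 : p.1 ≠ p.2 := fun h => hBA _ hp1 (h ▸ hp2A)
        set w₁ := wL (Lt \ insert e L') with hw₁
        -- pinning `e` closed on top of `w₁` is `wL (Lt ∖ L')`
        have hpin1 : pinW w₁ {e} ∅ = wL (Lt \ L') := by
          simp only [hw₁, hwL]
          rw [pinW_pinW_same]
          congr 1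
          ext f
          simp only [Set.mem_union, Finset.mem_coe, Finset.mem_sdiff, Finset.mem_insert, Set.mem_singleton_iff]
          constructor
          · rintro (⟨hf, hf'⟩ | rfl)
            · exact ⟨hf, fun h => hf' (Or.inr h)⟩
            · exact ⟨heLt, heL'⟩
          · rintro ⟨hf, hf'⟩
            by_cases hfe : f = e
            · exact Or.inr hfe
            · exact Or.inl ⟨hf, fun h => h.elim hfe hf'⟩
        -- the sure pairs joining `e` to `c`
        set S : Finset (Sym2 (Fin n)) := {s(o, p.1), s(o, x), s(x, c)} with hSdef
        have hw₁_of_notLt : ∀ f : Sym2 (Fin n), f ∉ Lt → w₁ f = wf f := by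
          intro f hf
          simp only [hw₁, hwL]
          exact pinW_apply_of_not_mem wf _ (fun h => hf (Finset.mem_sdiff.1 (Finset.mem_coe.1 h)).1)
        have hS : ∀ f ∈ S, w₁ f = 1 := by
          intro f hf
          simp only [hSdef, Finset.mem_insert, Finset.mem_singleton] at hf
          rcases hf with rfl | rfl | rfl
          · rw [hw₁_of_notLt _ (hstar_notLt _), hwf_star _ hp1]
          · rw [hw₁_of_notLt _ (hstar_notLt _), hwf_star _ hx]
          · rw [hw₁_of_notLt _ hxc_notLt, hwf_xc]
        have heS : e ∉ S := by
          simp only [hSdef, Finset.mem_insert, Finset.mem_singleton, ← hpe]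
          rintro (h | h | h)
          · rcases Sym2.eq_iff.1 h with ⟨h1, _⟩ | ⟨_, h2⟩
            · exact hp1o h1
            · exact hoA (h2 ▸ hp2A)
          · rcases Sym2.eq_iff.1 h with ⟨h1, _⟩ | ⟨_, h2⟩
            · exact hp1o h1
            · exact hoA (h2 ▸ hp2A)
          · rcases Sym2.eq_iff.1 h with ⟨_, h2⟩ | ⟨_, h2⟩
            · exact lt_irrefl _ (h2 ▸ hp2c)
            · exact hxA (h2 ▸ hp2A)
        have hclus : ∀ ω : BondConfig (Fin n), e ∈ ω → (↑S : Set (Sym2 (Fin n))) ⊆ ω →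
            insert e (↑S : Set (Sym2 (Fin n))) ⊆ openEdgeCluster ω c := by
          intro ω heω hSω
          have m1 : s(o, p.1) ∈ ω := hSω (by simp [hSdef])
          have m2 : s(o, x) ∈ ω := hSω (by simp [hSdef])
          have m3 : s(x, c) ∈ ω := hSω (by simp [hSdef])
          have rcx : (openGraph ω).Reachable c x :=
            SimpleGraph.Adj.reachable ((openGraph_adj ω c x).2 ⟨by rw [Sym2.eq_swap]; exact m3, hxc.symm⟩)
          have rco : (openGraph ω).Reachable c o :=
            rcx.trans (SimpleGraph.Adj.reachable ((openGraph_adj ω x o).2 ⟨by rw [Sym2.eq_swap]; exact m2, hxo⟩))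
          have rcp1 : (openGraph ω).Reachable c p.1 :=
            rco.trans (SimpleGraph.Adj.reachable ((openGraph_adj ω o p.1).2 ⟨m1, hp1o.symm⟩))
          have rcp2 : (openGraph ω).Reachable c p.2 :=
            rcp1.trans (SimpleGraph.Adj.reachable ((openGraph_adj ω p.1 p.2).2 ⟨hpe ▸ heω, hp12⟩))
          have mk : ∀ u v : Fin n, s(u, v) ∈ ω → u ≠ v → (openGraph ω).Reachable c u →
              (openGraph ω).Reachable c v → s(u, v) ∈ openEdgeCluster ω c := by
            intro u v huv hne hu hv
            refine ⟨huv, by rw [Sym2.mk_isDiag_iff]; exact hne, fun y hy => ?_⟩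
            rcases Sym2.mem_iff.1 hy with rfl | rfl
            · exact hu
            · exact hv
          intro f hf
          rcases Set.mem_insert_iff.1 hf with rfl | hf
          · rw [← hpe]; exact mk p.1 p.2 (hpe ▸ heω) hp12 rcp1 rcp2
          · simp only [hSdef, Finset.coe_insert, Finset.coe_singleton, Set.mem_insert_iff,
              Set.mem_singleton_iff] at hf
            rcases hf with rfl | rfl | rfl
            · exact mk o p.1 m1 hp1o.symm rco rcp1
            · exact mk o x m2 hxo.symm rco rcx
            · exact mk x c m3 hxc rcx (SimpleGraph.Reachable.refl _)
        exact (le_of_le_closed w₁ a c b e S hS heS hclus (by rw [hpin1]; exact ih')).1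
  have hfin := hind Lt (Finset.Subset.refl _)
  rw [Finset.sdiff_self] at hfin
  have hwL0 : wL ∅ = wf := by
    funext f
    simp only [hwL]
    exact pinW_apply_of_not_mem wf _ (by simp)
  rw [hwL0] at hfin
  exact hfin


end

end Summit.CriticalPhenomena.PercolationContinuityZ3.Theorems
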